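import Mathlib
import Summits.KontsevichZagierPeriods.Zeta5Search.BigPrimeWindowSharp
import HarnessLib.Audit
import HarnessLib

/-!
# ζ(5) search — `k = 7`: the prime `p = 3` for the ζ(5)-coefficient `U(b)` — the `U`-window starts at `max(3, L₂)`

Cell `pub-zeta5` (HONEST FRAMING: systematic search; no irrationality claim unless certified).  Provenance: written
by the family-designer seat `pub-zeta5-fam-vwp-g14` (planner role, no stage permission; staged for the cell's lane).
OUR theorems (Summit side; coefficient arithmetic only, no irrationality content).

For `b ∈ ℤ⁸` in the Brown–Zudilin polytope of the `k = 7` family (`InBox`, `2b_j ≤ b₀`, `Σ b_j ≤ 3b₀`;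
`d(b) = 3b₀ − Σ b_j`), the tree proves the two-level window law for the ζ(5)-coefficient `U(b)` of
`F̃₇(b) = 2W(b)ζ(3) + 2U(b)ζ(5) − V(b)` with the threshold `p ≥ 5` (`BigPrimeWindow.one_le_padicValRat_coeffU_of_slots`:
slots `j₁` dropped, `j₂ ≠ j₁`, `b_{j₂} ≤ b_{j₃} ≤ b_j` for `j ∉ {j₁, j₂}`, `L₂ = b₀ + 1 − b_{j₂} − b_{j₃} ≤ p`,
`2p ≤ d(b) + 1` ⟹ `v_p(U) ≥ 1`), its sharp end `2p = d(b) + 2` (`BigPrimeWindowSharp…coeffU_half_excess_add_one_of_slots`,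
`v_p(U) = 0`) and the end residue `U ≡ 2 (mod p)` (`…padicNorm_coeffU_sub_two_le_of_slots`), all for `p ≥ 5` only:
the level-2 shifted congruence `BigPrimeDual2.z2_cast` is stated with a uniform precision `X^4 ∣ X^{p−1}`, i.e. `p ≥ 5`.
But `U` is read off the power sum `Σ_{x∈𝔽_p} [X^3] M2(X + x)` — read index `3` — so the natural threshold is `p = 3`,
where the index is CRITICAL (`3 = p`), exactly the situation of `W` at `p = 5` (`BigPrimeWindowCritical`) and of `K₇`
at `p = 3` in the nine-block box (`BigPrimeNineThree`).  THIS FILE closes that last instance for the `k = 7` box: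

* `z2_cast'`, `Z2sum_cast'`: the level-2 congruence `Z2_i ≡ U2·Σ_x [X^{i+2}] M2(X + x) (mod p)` with the precision
  `X^{i+1}` in place of `X^4`, hence under `i + 2 ≤ p` instead of `5 ≤ p` (port of the `k = 9` form
  `BigPrimeNineDual2.z2_cast`; the tree's `z2_cast` is the case `p ≥ 5`);
* **`one_le_padicValRat_coeffU_of_slots'`**: EVERY prime `p ≥ 3` with `L₂ ≤ p` and `2p ≤ d(b) + 1` has `v_p(U(b)) ≥ 1`
  (if `U(b) ≠ 0`) — the `U`-window is `[max(3, L₂), (d+1)/2]`; at `p = 3` the count is the second-order one: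
  `(X^3 − X)² ∣ M2` (`BigPrimeWindowCritical.X_pow_card_sub_X_sq_dvd_M2'`) and `deg M2 = 19 − 2d(b) ≤ 9 < 11 = p² + p − 1`
  (`BigPrimeNine.sum_taylor_coeff_card_eq_zero`);
* **`padicValRat_coeffU_half_excess_add_one_of_slots'`**, **`padicNorm_coeffU_sub_two_le_of_slots'`**: for every prime
  `p ≥ 3` with `L₂ ≤ p` and `2p = d(b) + 2`: `U(b) ≠ 0`, `v_p(U(b)) = 0` and `‖U(b) − 2‖_p ≤ p⁻¹` (`U ≡ 2 (mod p)`) — at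
  `p = 3` (`d = 4`) `deg M2 = 11 = p² + p − 1` is the critical top and the power sum is `lc M2 = 2`
  (`BigPrimeNine.sum_taylor_coeff_card_top`); `padicNorm_coeffU_sub_two_le'` is the slot-free form above `b₀`.

So the `k = 7` two-level picture reads: `W`-window `[max(5, L₂), d+1]`, `U`-window `[max(3, L₂), (d+1)/2]`, both ends
attained with residue `2`, and BOTH thresholds are sharp as primes — EXACT check `pub-zeta5-fam-vwp/g14/u7_p3_scan.py`
(`b₀ ≤ 60`, admissible slot multisets): (U)₇ at `p = 3`: law `87/87` (all `v₃ = 1`), end `115/115` units, `115/115`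
with residue `2` — now theorems; (W)₇ at `p = 3` FAILS in `352` of `596` (read index `5 > 3`); and at `p = 2` (read
index `3 > 2`) the `U`-end is NOT sharp (`29/29` have `v₂ = 1`), so `3` is the true bottom of the `U`-window.
Instances: `b = (3;0,0,1,1,1,1,1)`: `d = 4 = 2·3 − 2`, `L₂ = 3`, `U = 7/2 ≡ 2 (mod 3)` (`7/2 − 2 = 3/2`);
`b = (4;1,1,1,1,1,1,1)`: `d = 5`, `2·3 ≤ d + 1`, `L₂ = 3`, `U = −51/8 = −3·17/8`; above `b₀`: `b = (2;1,1,0,0,0,0,0)`,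
`p = 3 = b₀ + 1`, `d = 4`, `U = 2` exactly.
-/

noncomputable section

open Finset Polynomial

namespace Summit.KontsevichZagierPeriods.Zeta5Search.BigPrime

open Summit.KontsevichZagierPeriods.Zeta5Search.DualSeries (InBox)
open Summit.KontsevichZagierPeriods.Zeta5Search.WedgeDictionary (IsPFData coeffU coeffU_eq exists_isPFData dOf)
open Summit.KontsevichZagierPeriods.Zeta5Search.BigPrimeNine (sum_taylor_coeff_card_eq_zero sum_taylor_coeff_card_top
  two_ne_zero_zmod padicNorm_sub_two_le)

/-! ### 1. The level-2 shifted congruence with precision `X^{i+1}` (`i + 2 ≤ p`) -/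

section ModP2

variable {p : ℕ} [hp : Fact p.Prime]

/-- **Level-2 shifted congruence, every read index below `p`**: for `q ∈ S'`, `i < 4` and `i + 2 ≤ p`,
`z2_{q,i} ≡ e20(q)^6 · [X^{i+2}] M2(X − q) (mod p)`.  The tree's `z2_cast` is the case `p ≥ 5` (uniform precision
`X^4`); here the comparison is made modulo `X^{i+1}`, which only needs `X^{i+1} ∣ X^{p−1}`. -/
theorem z2_cast' {n : ℕ} {β : ℕ → ℕ} {j₁ j₂ j₃ : ℕ} (hj₁ : j₁ ∈ range 7)
    (hj₂ : j₂ ∈ (range 7).erase j₁) (hS : n + 1 ≤ p + 2 * β j₃) (hT : n + 1 ≤ p + β j₂ + β j₃)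
    (h23 : β j₂ ≤ β j₃) (h3 : 2 * β j₃ ≤ n) (hmin : ∀ j ∈ ((range 7).erase j₁).erase j₂, β j₃ ≤ β j)
    {q : ℕ} (hq : q ∈ block n (β j₃)) {i : ℕ} (hi : i < 4) (hip : i + 2 ≤ p) :
    ((z2 n β j₁ j₂ j₃ q i : ℤ) : ZMod p) =
      ((e20 n β j₂ j₃ q : ℤ) : ZMod p) ^ 6 * (taylor (-((q : ℕ) : ZMod p)) (M2 p n β j₁ j₂ j₃)).coeff (i + 2) := by
  have hq' := hq
  rw [block, mem_Icc] at hq'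
  set r : ZMod p := -((q : ℕ) : ZMod p) with hr
  set NF := taylor r (num2 (ZMod p) n β j₁ j₂ j₃) with hNF
  set EF := E2 (ZMod p) n β j₂ j₃ q with hEF
  set JF := truncInv EF 6 with hJF
  -- two factors X from the rim complements
  have hXL : (X : (ZMod p)[X]) ∣ taylor r (KC p (rimL (β j₂) (β j₃))) := by
    have hmem : -r ∈ univ \ (rimL (β j₂) (β j₃)).image (Nat.cast : ℕ → ZMod p) := by
      rw [mem_sdiff]; refine ⟨mem_univ _, fun h => ?_⟩
      obtain ⟨s, hs, hsq⟩ := mem_image.1 h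
      rw [rimL, mem_Ico] at hs
      rw [hr, neg_neg] at hsq
      have hm := (ZMod.natCast_eq_natCast_iff s q p).1 hsq
      have := hm.eq_of_abs_lt (by rw [abs_lt]; constructor <;> omega)
      omega
    rw [KC, taylor_prod']
    have hfac : taylor r (X + C (-r)) = X := by rw [taylor_X_add_C, neg_add_cancel, C_0, add_zero]
    exact (dvd_of_eq hfac.symm).trans (Finset.dvd_prod_of_mem (fun u : ZMod p => taylor r (X + C u)) hmem)
  have hXR : (X : (ZMod p)[X]) ∣ taylor r (KC p (rimR n (β j₂) (β j₃))) := by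
    have hmem : -r ∈ univ \ (rimR n (β j₂) (β j₃)).image (Nat.cast : ℕ → ZMod p) := by
      rw [mem_sdiff]; refine ⟨mem_univ _, fun h => ?_⟩
      obtain ⟨s, hs, hsq⟩ := mem_image.1 h
      rw [rimR, mem_Ioc] at hs
      rw [hr, neg_neg] at hsq
      have hm := (ZMod.natCast_eq_natCast_iff s q p).1 hsq
      have := hm.eq_of_abs_lt (by rw [abs_lt]; constructor <;> omega)
      omega
    rw [KC, taylor_prod']
    have hfac : taylor r (X + C (-r)) = X := by rw [taylor_X_add_C, neg_add_cancel, C_0, add_zero]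
    exact (dvd_of_eq hfac.symm).trans (Finset.dvd_prod_of_mem (fun u : ZMod p => taylor r (X + C u)) hmem)
  obtain ⟨ML, hML⟩ := hXL
  obtain ⟨MR, hMR⟩ := hXR
  -- M2(X − q) = X² · Mt
  set Mt := taylor r (C 2 * X + C (n : ZMod p)) * taylor r (∏ s ∈ range (n + 1) \ block n (β j₁), (X + C (s : ZMod p))) *
    (taylor r (∏ j ∈ ((range 7).erase j₁).erase j₂, KF p n (β j)) * taylor r (KF p n (β j₃)) * (ML * MR)) with hMt
  have hM2 : taylor r (M2 p n β j₁ j₂ j₃) = X ^ 2 * Mt := by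
    rw [M2, taylor_mul, taylor_mul, taylor_mul, taylor_mul, taylor_mul, hML, hMR, hMt]; ring
  -- shift the identity
  have hshift := congrArg (taylor r) (pS_pow_mul_rim_mul_M2 hj₁ hj₂ hS hT h23 h3 hmin)
  rw [taylor_mul, taylor_mul, taylor_pow, taylor_pS hq, taylor_mul, taylor_pow, taylor_X_pow_card_sub_X, hM2,
    taylor_prod'] at hshift
  have hRim : ∏ s ∈ rim n (β j₂) (β j₃), taylor r (X + C (s : ZMod p)) =
      ∏ s ∈ rim n (β j₂) (β j₃), (X + C ((s : ZMod p) - q)) :=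
    prod_congr rfl fun s _ => by rw [taylor_X_add_C, sub_eq_add_neg]
  rw [hRim] at hshift
  have hXp : (X ^ p - X : (ZMod p)[X]) = X * (X ^ (p - 1) - 1) := by
    have h : (X : (ZMod p)[X]) ^ p = X * X ^ (p - 1) := by
      rw [← pow_succ', Nat.sub_add_cancel hp.out.one_le]
    rw [h]; ring
  rw [hXp] at hshift
  have hcancel : EF * Mt = NF * (X ^ (p - 1) - 1) ^ 8 := by
    have h8 : (X : (ZMod p)[X]) ^ 8 ≠ 0 := pow_ne_zero _ X_ne_zero
    apply mul_left_cancel₀ h8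
    rw [hEF, E2, prod_pow, hNF]
    linear_combination hshift
  have hY : (X : (ZMod p)[X]) ^ (p - 1) ∣ (X ^ (p - 1) - 1) ^ 8 - 1 := by
    have := sub_dvd_pow_sub_pow (X ^ (p - 1) - 1 : (ZMod p)[X]) (-1) 8
    rw [sub_neg_eq_add, sub_add_cancel] at this
    refine this.trans (dvd_of_eq ?_)
    ring
  -- precision `X^{i+1}` (instead of the tree's uniform `X^4`, which costs `p ≥ 5`): `i + 1 ≤ p − 1`
  have hN : (X : (ZMod p)[X]) ^ (i + 1) ∣ X ^ (p - 1) := pow_dvd_pow X (by omega)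
  have hA : (X : (ZMod p)[X]) ^ (i + 1) ∣ EF * Mt - NF := by
    rw [hcancel, show NF * (X ^ (p - 1) - 1) ^ 8 - NF = NF * ((X ^ (p - 1) - 1) ^ 8 - 1) by ring]
    exact (hN.trans hY).mul_left _
  have hB : (X : (ZMod p)[X]) ^ (i + 1) ∣ (EF * JF - C (EF.coeff 0 ^ 6)) * Mt :=
    ((pow_dvd_pow X (by omega : i + 1 ≤ 6)).trans (truncInv_spec EF 6)).mul_right _
  have hC : (X : (ZMod p)[X]) ^ (i + 1) ∣ NF * JF - C (EF.coeff 0 ^ 6) * Mt := by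
    have : NF * JF - C (EF.coeff 0 ^ 6) * Mt = (EF * JF - C (EF.coeff 0 ^ 6)) * Mt - (EF * Mt - NF) * JF := by
      ring
    rw [this]
    exact dvd_sub hB (hA.mul_right _)
  have hcoeff := coeff_eq_of_X_pow_dvd_sub hC (Nat.lt_succ_self i)
  have he0 : EF.coeff 0 = ((e20 n β j₂ j₃ q : ℤ) : ZMod p) := by
    rw [hEF, ← E2_map (Int.castRingHom (ZMod p)), coeff_map, E2_coeff_zero]; simp
  have hL : NF * JF = (taylor (-(q : ℤ)) (num2 ℤ n β j₁ j₂ j₃) * truncInv (E2 ℤ n β j₂ j₃ q) 6).map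
      (Int.castRingHom (ZMod p)) := by
    rw [Polynomial.map_mul, map_taylor, num2_map, truncInv_map, E2_map]
    simp [hNF, hJF, hEF, hr]
  have hMt' : Mt.coeff i = (taylor r (M2 p n β j₁ j₂ j₃)).coeff (i + 2) := by
    rw [hM2, coeff_X_pow_mul]
  rw [hL, coeff_map, he0, coeff_C_mul, hMt'] at hcoeff
  have hz : ((z2 n β j₁ j₂ j₃ q i : ℤ) : ZMod p) = (Int.castRingHom (ZMod p))
      ((taylor (-(q : ℤ)) (num2 ℤ n β j₁ j₂ j₃) * truncInv (E2 ℤ n β j₂ j₃ q) 6).coeff i) := by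
    simp [z2]
  rw [hz, hcoeff]

/-- `Z2_i ≡ U2 · Σ_x [X^{i+2}] M2(X + x) (mod p)` for `i < 4`, `i + 2 ≤ p` (the tree's `Z2sum_cast` for `p ≥ 5`). -/
theorem Z2sum_cast' {n : ℕ} {β : ℕ → ℕ} {j₁ j₂ j₃ : ℕ} (hj₁ : j₁ ∈ range 7) (hj₂ : j₂ ∈ (range 7).erase j₁)
    (hS : n + 1 ≤ p + 2 * β j₃) (hT : n + 1 ≤ p + β j₂ + β j₃) (h23 : β j₂ ≤ β j₃) (h3 : 2 * β j₃ ≤ n)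
    (hmin : ∀ j ∈ ((range 7).erase j₁).erase j₂, β j₃ ≤ β j) {i : ℕ} (hi : i < 4) (hip : i + 2 ≤ p) :
    ((Z2sum n β j₁ j₂ j₃ i : ℤ) : ZMod p) =
      ((U2all n β j₂ j₃ : ℤ) : ZMod p) * ∑ x : ZMod p, (taylor x (M2 p n β j₁ j₂ j₃)).coeff (i + 2) := by
  rw [sum_univ_taylor_M2_coeff hj₁ hj₂ hS hmin (by omega), Z2sum, mul_sum]
  push_cast
  refine sum_congr rfl fun q hq => ?_
  rw [z2_cast' hj₁ hj₂ hS hT h23 h3 hmin hq hi hip, U2all, ← mul_prod_erase _ _ hq]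
  push_cast
  ring

/-- The leading coefficient of the `k = 7` level-2 dual polynomial `M2` is `2` (`p ≥ 3`).  (File-local copy: the tree's
`BigPrimeWindowSharp.leadingCoeff_M2` is `private`.) -/
private theorem leadingCoeff_M2_seven (hp3 : 3 ≤ p) (n : ℕ) (β : ℕ → ℕ) (j₁ j₂ j₃ : ℕ) :
    (M2 p n β j₁ j₂ j₃).leadingCoeff = 2 := by
  have h2z := two_ne_zero_zmod hp3
  have hmidm : (∏ s ∈ range (n + 1) \ block n (β j₁), (X + C (s : ZMod p))).Monic :=
    monic_prod_of_monic _ _ fun s _ => monic_X_add_C _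
  have hKFm : ∀ βj : ℕ, (KF p n βj).Monic := fun βj => monic_prod_of_monic _ _ fun u _ => monic_X_add_C _
  have hKCm : ∀ T : Finset ℕ, (KC p T).Monic := fun T => monic_prod_of_monic _ _ fun u _ => monic_X_add_C _
  have hprodm : (∏ j ∈ ((range 7).erase j₁).erase j₂, KF p n (β j)).Monic :=
    monic_prod_of_monic _ _ fun j _ => hKFm _
  rw [M2, leadingCoeff_mul, leadingCoeff_mul, leadingCoeff_linear h2z, hmidm.leadingCoeff,
    ((hprodm.mul (hKFm _)).mul ((hKCm _).mul (hKCm _))).leadingCoeff, mul_one, mul_one]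

end ModP2

/-! ### 2. The `U`-window from `p = 3` on -/

section Slots

/-- Slot bookkeeping (`ℤ`-data ↦ `ℕ`-data), as in `BigPrimeWindowSharp` (where it is private). -/
private theorem slot_data7' (b : ℕ → ℤ) {p j₁ j₂ j₃ : ℕ} (hb : InBox b) (h2 : ∀ i ∈ range 7, 2 * b (i + 1) ≤ b 0)
    (hj₂ : j₂ ∈ range 7) (hj₃ : j₃ ∈ range 7) (h12 : j₂ ≠ j₁) (hle : b (j₂ + 1) ≤ b (j₃ + 1))
    (hmin : ∀ j ∈ range 7, j ≠ j₁ → j ≠ j₂ → b (j₃ + 1) ≤ b (j + 1))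
    (hpT : b 0 + 1 ≤ (p : ℤ) + b (j₂ + 1) + b (j₃ + 1)) :
    j₂ ∈ (range 7).erase j₁ ∧ (b (j₂ + 1)).toNat ≤ (b (j₃ + 1)).toNat ∧
      (∀ j ∈ ((range 7).erase j₁).erase j₂, (b (j₃ + 1)).toNat ≤ (b (j + 1)).toNat) ∧
      (b 0).toNat + 1 ≤ p + (b (j₂ + 1)).toNat + (b (j₃ + 1)).toNat ∧
      (b 0).toNat + 1 ≤ p + 2 * (b (j₃ + 1)).toNat ∧ 2 * (b (j₃ + 1)).toNat ≤ (b 0).toNat := by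
  have h02 : 0 ≤ b (j₂ + 1) := (hb.2 j₂ hj₂).1
  have h03 : 0 ≤ b (j₃ + 1) := (hb.2 j₃ hj₃).1
  have e0 : (b 0 : ℤ) = ((b 0).toNat : ℤ) := (Int.toNat_of_nonneg hb.1).symm
  have e2 : (b (j₂ + 1) : ℤ) = ((b (j₂ + 1)).toNat : ℤ) := (Int.toNat_of_nonneg h02).symm
  have e3 : (b (j₃ + 1) : ℤ) = ((b (j₃ + 1)).toNat : ℤ) := (Int.toNat_of_nonneg h03).symm
  have h3j := h2 j₃ hj₃
  refine ⟨mem_erase.2 ⟨h12, hj₂⟩, Int.toNat_le_toNat hle, ?_, by omega, by omega, by omega⟩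
  intro j hj
  have hj' := mem_erase.1 hj; have hj'' := mem_erase.1 hj'.2
  exact Int.toNat_le_toNat (hmin j hj''.2 hj''.1 hj'.1)

/-- (U∞) at level 2, cleared form, for ALL primes `p ≥ 3` (`b₀ + 1 ≤ p + b_{j₂} + b_{j₃}`, `2p ≤ d(b) + 1`): `p ≥ 5` is
the tree's `exists_clear_coeffU_of_slots`; at `p = 3` the read index `3 = p` is critical and the second-order count
applies (`(X^3 − X)² ∣ M2`, `deg M2 ≤ 9 < 11`). -/
theorem exists_clear_coeffU_of_slots' (b : ℕ → ℤ) (p j₁ j₂ j₃ : ℕ) (hb : InBox b)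
    (h2 : ∀ i ∈ range 7, 2 * b (i + 1) ≤ b 0) (h3 : ∑ i ∈ range 7, b (i + 1) ≤ 3 * b 0)
    (hj₁ : j₁ ∈ range 7) (hj₂ : j₂ ∈ range 7) (hj₃ : j₃ ∈ range 7) (h12 : j₂ ≠ j₁)
    (hle : b (j₂ + 1) ≤ b (j₃ + 1)) (hmin : ∀ j ∈ range 7, j ≠ j₁ → j ≠ j₂ → b (j₃ + 1) ≤ b (j + 1))
    (hprime : p.Prime) (hp3 : 3 ≤ p) (hpT : b 0 + 1 ≤ (p : ℤ) + b (j₂ + 1) + b (j₃ + 1))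
    (hpd : 2 * (p : ℤ) ≤ dOf b + 1) :
    ∃ U Z : ℤ, ¬ (p : ℤ) ∣ U ∧ (p : ℤ) ∣ Z ∧ (U : ℚ) * coeffU b = Z := by
  by_cases hp5 : 5 ≤ p
  · exact exists_clear_coeffU_of_slots b p j₁ j₂ j₃ hb h2 h3 hj₁ hj₂ hj₃ h12 hle hmin hprime hp5 hpT hpd
  have hlt : p < 5 := by omega
  obtain rfl : p = 3 := by
    interval_cases p
    · rfl
    all_goals exact absurd hprime (by decide)
  haveI : Fact (Nat.Prime 3) := ⟨hprime⟩
  obtain ⟨e0, hS, hβ, hS3⟩ := polytope_data b hb h2 h3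
  obtain ⟨hj₂', h23, hmin', hT', hS', h3'⟩ := slot_data7' b hb h2 hj₂ hj₃ h12 hle hmin hpT
  have hpd' : 2 * 3 + ∑ j ∈ range 7, (b (j + 1)).toNat ≤ 3 * (b 0).toNat + 1 := by
    have := hpd; rw [dOf, hS, e0] at this; omega
  have hhalf : ∀ j ∈ range 7, 2 * b (j + 1) ≤ b 0 + 1 := fun j hj => by have := h2 j hj; omega
  obtain ⟨c, hc⟩ := exists_isPFData b hb (by omega)
  refine ⟨_, _, not_dvd_U2all hprime hT' h23, ?_,
    by rw [coeffU_eq hc]; exact U2all_mul_sum_eq b hb hhalf hc hj₁ hj₂' h23 hmin' (by norm_num) (by norm_num : 4 < 6)⟩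
  rw [← ZMod.intCast_zmod_eq_zero_iff_dvd, Z2sum_cast' hj₁ hj₂' hS' hT' h23 h3' hmin' (by norm_num : 1 < 4) (by omega),
    sum_taylor_coeff_card_eq_zero (M2 3 (b 0).toNat (fun j => (b (j + 1)).toNat) j₁ j₂ j₃)
      (X_pow_card_sub_X_sq_dvd_M2' hj₁ hj₂' hT' h23 h3' hmin') ?_, mul_zero]
  have := natDegree_M2_le (p := 3) hj₁ hj₂' hS' hT' h23 hmin' hβ h3'
  beta_reduce at this
  omega

/-- **(U∞) ON THE WHOLE WINDOW, from `p = 3` on.**  Let `b` lie in the Brown–Zudilin polytope (`2b_j ≤ b₀`, `Σ b_j ≤ 3b₀`);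
drop a slot `j₁`, let `j₂ ≠ j₁` be a slot with `b_{j₂} ≤ b_{j₃}` and `j₃` one with `b_{j₃} ≤ b_j` for all `j ∉ {j₁, j₂}`.
Then EVERY prime `p ≥ 3` with `b₀ + 1 − b_{j₂} − b_{j₃} ≤ p` and `2p ≤ d(b) + 1` has `v_p(U(b)) ≥ 1` (if `U(b) ≠ 0`):
the threshold `5` of `one_le_padicValRat_coeffU_of_slots` was an artefact of the uniform precision in `z2_cast`. -/
theorem one_le_padicValRat_coeffU_of_slots' (b : ℕ → ℤ) (p j₁ j₂ j₃ : ℕ) (hb : InBox b)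
    (h2 : ∀ i ∈ range 7, 2 * b (i + 1) ≤ b 0) (h3 : ∑ i ∈ range 7, b (i + 1) ≤ 3 * b 0)
    (hj₁ : j₁ ∈ range 7) (hj₂ : j₂ ∈ range 7) (hj₃ : j₃ ∈ range 7) (h12 : j₂ ≠ j₁)
    (hle : b (j₂ + 1) ≤ b (j₃ + 1)) (hmin : ∀ j ∈ range 7, j ≠ j₁ → j ≠ j₂ → b (j₃ + 1) ≤ b (j + 1))
    (hprime : p.Prime) (hp3 : 3 ≤ p) (hpT : b 0 + 1 ≤ (p : ℤ) + b (j₂ + 1) + b (j₃ + 1))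
    (hpd : 2 * (p : ℤ) ≤ dOf b + 1) (hU : coeffU b ≠ 0) : 1 ≤ padicValRat p (coeffU b) := by
  haveI : Fact p.Prime := ⟨hprime⟩
  obtain ⟨U, Z, hU', hZ, hUU⟩ :=
    exists_clear_coeffU_of_slots' b p j₁ j₂ j₃ hb h2 h3 hj₁ hj₂ hj₃ h12 hle hmin hprime hp3 hpT hpd
  exact one_le_padicValRat_of_eq hUU hU' hZ hU

/-! ### 3. The end `2p = d(b) + 2` from `p = 3` on: a unit with residue `2` -/

/-- **(U∞)₇ IS SHARP IN THE TWO-LEVEL SLOT REGIME, from `p = 3` on**: same slots, `p ≥ 3` prime,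
`b₀ + 1 ≤ p + b_{j₂} + b_{j₃}`, `2p = d(b) + 2` ⟹ `U(b) ≠ 0 ∧ v_p(U(b)) = 0`.  (`p ≥ 5`:
`padicValRat_coeffU_half_excess_add_one_of_slots`; at `p = 3` `deg M2 = 11 = p² + p − 1` is the critical top and
`Σ_x [X^3] M2(X + x) = lc M2 = 2 ≠ 0`.) -/
theorem padicValRat_coeffU_half_excess_add_one_of_slots' (b : ℕ → ℤ) (p j₁ j₂ j₃ : ℕ) (hb : InBox b)
    (h2 : ∀ i ∈ range 7, 2 * b (i + 1) ≤ b 0) (h3 : ∑ i ∈ range 7, b (i + 1) ≤ 3 * b 0)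
    (hj₁ : j₁ ∈ range 7) (hj₂ : j₂ ∈ range 7) (hj₃ : j₃ ∈ range 7) (h12 : j₂ ≠ j₁)
    (hle : b (j₂ + 1) ≤ b (j₃ + 1)) (hmin : ∀ j ∈ range 7, j ≠ j₁ → j ≠ j₂ → b (j₃ + 1) ≤ b (j + 1))
    (hprime : p.Prime) (hp3 : 3 ≤ p) (hpT : b 0 + 1 ≤ (p : ℤ) + b (j₂ + 1) + b (j₃ + 1))
    (hpd : 2 * (p : ℤ) = dOf b + 2) : coeffU b ≠ 0 ∧ padicValRat p (coeffU b) = 0 := by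
  by_cases hp5 : 5 ≤ p
  · exact padicValRat_coeffU_half_excess_add_one_of_slots b p j₁ j₂ j₃ hb h2 h3 hj₁ hj₂ hj₃ h12 hle hmin hprime hp5
      hpT hpd
  have hlt : p < 5 := by omega
  obtain rfl : p = 3 := by
    interval_cases p
    · rfl
    all_goals exact absurd hprime (by decide)
  haveI : Fact (Nat.Prime 3) := ⟨hprime⟩
  obtain ⟨e0, hS, hβ, hS3⟩ := polytope_data b hb h2 h3
  obtain ⟨hj₂', h23, hmin', hT', hS', h3'⟩ := slot_data7' b hb h2 hj₂ hj₃ h12 hle hmin hpT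
  have hpd' : 2 * 3 + ∑ j ∈ range 7, (b (j + 1)).toNat = 3 * (b 0).toNat + 2 := by
    have := hpd; rw [dOf, hS, e0] at this; omega
  have hhalf : ∀ j ∈ range 7, 2 * b (j + 1) ≤ b 0 + 1 := fun j hj => by have := h2 j hj; omega
  obtain ⟨c, hc⟩ := exists_isPFData b hb (by omega)
  have hUK := U2all_mul_sum_eq b hb hhalf hc hj₁ hj₂' h23 hmin' (o := 4) (by norm_num) (by norm_num)
  rw [← coeffU_eq hc] at hUK
  refine padicValRat_eq_zero_of_eq hUK (not_dvd_U2all hprime hT' h23) ?_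
  have hdeg : (M2 3 (b 0).toNat (fun j => (b (j + 1)).toNat) j₁ j₂ j₃).natDegree = 11 := by
    have := natDegree_M2_eq (p := 3) (by norm_num) hj₁ hj₂' hS' hT' h23 hmin' hβ h3'
    beta_reduce at this
    omega
  have hU : ((U2all (b 0).toNat (fun j => (b (j + 1)).toNat) j₂ j₃ : ℤ) : ZMod 3) ≠ 0 := by
    rw [Ne, ZMod.intCast_zmod_eq_zero_iff_dvd]; exact not_dvd_U2all hprime hT' h23
  have htwo : (2 : ZMod 3) ≠ 0 := two_ne_zero_zmod (by norm_num)
  rw [← ZMod.intCast_zmod_eq_zero_iff_dvd, Z2sum_cast' hj₁ hj₂' hS' hT' h23 h3' hmin' (by norm_num : 1 < 4) (by omega),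
    sum_taylor_coeff_card_top (by norm_num) _ (X_pow_card_sub_X_sq_dvd_M2' hj₁ hj₂' hT' h23 h3' hmin') (by omega),
    leadingCoeff_M2_seven (by norm_num)]
  exact mul_ne_zero hU htwo

/-- **`U(b) ≡ 2 (mod p)` AT THE END `2p = d(b) + 2`, from `p = 3` on** (slot regime): same hypotheses as
`padicValRat_coeffU_half_excess_add_one_of_slots'` ⟹ `‖U(b) − 2‖_p ≤ p⁻¹`. -/
theorem padicNorm_coeffU_sub_two_le_of_slots' (b : ℕ → ℤ) (p j₁ j₂ j₃ : ℕ) (hb : InBox b)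
    (h2 : ∀ i ∈ range 7, 2 * b (i + 1) ≤ b 0) (h3 : ∑ i ∈ range 7, b (i + 1) ≤ 3 * b 0)
    (hj₁ : j₁ ∈ range 7) (hj₂ : j₂ ∈ range 7) (hj₃ : j₃ ∈ range 7) (h12 : j₂ ≠ j₁)
    (hle : b (j₂ + 1) ≤ b (j₃ + 1)) (hmin : ∀ j ∈ range 7, j ≠ j₁ → j ≠ j₂ → b (j₃ + 1) ≤ b (j + 1))
    (hprime : p.Prime) (hp3 : 3 ≤ p) (hpT : b 0 + 1 ≤ (p : ℤ) + b (j₂ + 1) + b (j₃ + 1))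
    (hpd : 2 * (p : ℤ) = dOf b + 2) : padicNorm p (coeffU b - 2) ≤ (p : ℚ)⁻¹ := by
  by_cases hp5 : 5 ≤ p
  · exact padicNorm_coeffU_sub_two_le_of_slots b p j₁ j₂ j₃ hb h2 h3 hj₁ hj₂ hj₃ h12 hle hmin hprime hp5 hpT hpd
  have hlt : p < 5 := by omega
  obtain rfl : p = 3 := by
    interval_cases p
    · rfl
    all_goals exact absurd hprime (by decide)
  haveI : Fact (Nat.Prime 3) := ⟨hprime⟩
  obtain ⟨e0, hS, hβ, hS3⟩ := polytope_data b hb h2 h3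
  obtain ⟨hj₂', h23, hmin', hT', hS', h3'⟩ := slot_data7' b hb h2 hj₂ hj₃ h12 hle hmin hpT
  have hpd' : 2 * 3 + ∑ j ∈ range 7, (b (j + 1)).toNat = 3 * (b 0).toNat + 2 := by
    have := hpd; rw [dOf, hS, e0] at this; omega
  have hhalf : ∀ j ∈ range 7, 2 * b (j + 1) ≤ b 0 + 1 := fun j hj => by have := h2 j hj; omega
  obtain ⟨c, hc⟩ := exists_isPFData b hb (by omega)
  have hUK := U2all_mul_sum_eq b hb hhalf hc hj₁ hj₂' h23 hmin' (o := 4) (by norm_num) (by norm_num)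
  rw [← coeffU_eq hc] at hUK
  refine padicNorm_sub_two_le hUK (not_dvd_U2all hprime hT' h23) ?_
  have hdeg : (M2 3 (b 0).toNat (fun j => (b (j + 1)).toNat) j₁ j₂ j₃).natDegree = 11 := by
    have := natDegree_M2_eq (p := 3) (by norm_num) hj₁ hj₂' hS' hT' h23 hmin' hβ h3'
    beta_reduce at this
    omega
  rw [← ZMod.intCast_zmod_eq_zero_iff_dvd]
  push_cast
  rw [Z2sum_cast' hj₁ hj₂' hS' hT' h23 h3' hmin' (by norm_num : 1 < 4) (by omega),
    sum_taylor_coeff_card_top (by norm_num) _ (X_pow_card_sub_X_sq_dvd_M2' hj₁ hj₂' hT' h23 h3' hmin') (by omega),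
    leadingCoeff_M2_seven (by norm_num)]
  ring

/-! ### 4. Slot-free form above `b₀` -/

/-- A minimiser of `b` over the blocks `1, …, 7`. -/
private theorem exists_slot_min7 (b : ℕ → ℤ) :
    ∃ j ∈ range 7, j ≠ 0 ∧ ∀ i ∈ range 7, i ≠ 0 → b (j + 1) ≤ b (i + 1) := by
  obtain ⟨j, hj, hjmin⟩ := ((range 7).erase 0).exists_min_image (fun j => b (j + 1)) ⟨1, by simp⟩
  exact ⟨j, mem_of_mem_erase hj, ne_of_mem_erase hj, fun i hi hi0 => hjmin i (mem_erase.2 ⟨hi0, hi⟩)⟩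

/-- **`U(b) ≡ 2 (mod p)` above `b₀`, from `p = 3` on**: `p` prime, `p ≥ 3`, `p ≥ b₀ + 1`, `2p = d(b) + 2` ⟹
`‖U(b) − 2‖_p ≤ p⁻¹` (slots `j₁ = 0`, `j₂ = j₃` a minimiser; extends `BigPrimeCongruence.padicNorm_coeffU_sub_two_le`
(`p ≥ 5`) to `p = 3`). -/
theorem padicNorm_coeffU_sub_two_le' (b : ℕ → ℤ) (p : ℕ) (hb : InBox b) (h2 : ∀ i ∈ range 7, 2 * b (i + 1) ≤ b 0)
    (h3 : ∑ i ∈ range 7, b (i + 1) ≤ 3 * b 0) (hprime : p.Prime) (hp3 : 3 ≤ p) (hpb : b 0 + 1 ≤ (p : ℤ))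
    (hpd : 2 * (p : ℤ) = dOf b + 2) : padicNorm p (coeffU b - 2) ≤ (p : ℚ)⁻¹ := by
  obtain ⟨j, hj, hj0, hjmin⟩ := exists_slot_min7 b
  have h0 := (hb.2 j hj).1
  exact padicNorm_coeffU_sub_two_le_of_slots' b p 0 j j hb h2 h3 (by simp) hj hj hj0 le_rfl
    (fun i hi hi0 _ => hjmin i hi hi0) hprime hp3 (by omega) hpd

end Slots

/-- The instances of the docstring and the critical budget: `(3;0,0,1,1,1,1,1)` is the end at `p = 3`
(`2·3 = d + 2 = 6`, `7/2 − 2 = 3·(1/2)`), `(4;1⁷)` lies in the window (`2·3 ≤ d + 1 = 6`, `−51/8 = 3·(−17/8)`);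
`p² + p − 1 = 11 = 4·3 − 1` at `p = 3` (the top degree `4p − 1` for the read index `3`). -/
example : (3 : ℤ) * 3 - 5 + 2 = 2 * 3 ∧ (7 : ℚ) / 2 - 2 = 3 * (1 / 2) ∧
    (3 : ℤ) * 4 - 7 + 1 = 2 * 3 ∧ (-51 : ℚ) / 8 = 3 * (-17 / 8) ∧
    2 * 3 + ((3 - 2) + (3 - 2 + 1) * (3 - 1)) = 4 * 3 - 1 := by norm_num

end Summit.KontsevichZagierPeriods.Zeta5Search.BigPrime

end
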